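/-
COR-CM (cell pub-hodgecm2) — TEAM hComp (coordinator ruling 2026-08-21T18:44:30Z), seat hcomp-level gen 28, table row U2d (HCOMP-TABLE):
DIAGONAL FRAME of the hermitian 3-space and the finite-adelic transport — item (m6′) of `hodge-director/CARRIERS-PLAN.md` v1.3
§2.R2 / §3 S3 / §4 (the `ι`-supplier of the ω file at `G := V.adelicFin`).  Count-neutral (no BINDER-OWNERS row, no hypothesis
binder, nothing cited as a record); HC_CM is NOT proved and nothing here bears on it.
-/
import Summits.HodgeConjecture.CorCM.HermSpaceTransport
import Literature.NumberTheory.QuadraticForms.LandherrHermitianMatricesDiagonalize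
import HarnessLib
import HarnessLib.Audit.LibrarySuggestionsDenyListCorCM   -- build-lane export guard for the CorCM transposition files (name component `CorCM`)

/-!
# COR-CM / hComp — an `L`-rational diagonal frame of the hermitian 3-space, and the finite-adelic transport

Let `L` be a CM field (`L⁺ = maximalRealSubfield L`, complex conjugation `c`), `ι₁ : L →+* ℂ`, and `V : HermSpace3 L ι₁` the
tree's hermitian 3-space (`CorCM/CM/Basic.lean`: Gram matrix `V.Hm ∈ M₃(L)`, hermitian for `c`, signature `(2,1)` at the place of
`ι₁`, positive definite at every other place; finite-adelic unitary group `V.adelicFin = U(V.Hm)(𝔸_{L⁺,f})`).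

The ω-side of [Liu2021] Thm. 4.18 (Def. 4.11, the Weil representation of the unitary dual pair `U(V) × U(W)`) is typed in the
tree over the Gelbart–Rogawski currency `J_V = T_V ⊗_{L⁺} L` with `T_V ∈ M_N(L⁺)` SYMMETRIC of unit determinant
(`Literature/NumberTheory/GelbartRogawski1991/UnitaryDualPairThetaKernel.lean`, hypotheses `hV hVd hJV`; in the CM currency
`Literature/NumberTheory/GelbartRogawski1991/UnitaryDualPairThetaKernelCM.lean`: `realDiagonal L d hd`,
`cmSplittingDatum L e dV hdV hdV0 …` for a conjugation-fixed non-zero diagonal `d : Fin N → L`).  A general hermitian Gram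
matrix `V.Hm` is not of that shape, but it is CONGRUENT over `L` to one: this file supplies

* `HermSpace3.exists_diagonalFrame` — `ᵗ(c̄B) · V.Hm · B = diag(d)` for some `B ∈ GL₃(L)` and some `d : Fin 3 → L` with
  `c̄ dᵢ = dᵢ ≠ 0` (symmetric Gauss elimination over the CM field: tree `Landherr.exists_congr_diagonal`,
  [Landherr1936HermitianForms], at `V.transpose_map_complexConj` / `V.det_ne_zero` of `CorCM/HermSpaceTransport.lean`);
* NAMED TERMS `V.diagFrame : GL (Fin 3) L`, `V.diagEntries : Fin 3 → L` (a CHOSEN frame, `Exists.choose`) with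
  `V.complexConj_diagEntries`, `V.diagEntries_ne_zero`, `V.formCongr_diagFrame` — literally the arguments `(dV, hdV, hdV0)` of
  `cmSplittingDatum` (the consumer sets `TV := realDiagonal L V.diagEntries V.complexConj_diagEntries`,
  `hJV := (realDiagonal_map …).symm`);
* `V.diag : HermSpace3 L ι₁` — the diagonal form `diag(V.diagEntries)` AS a hermitian 3-space with the SAME `ι₁`: the signature
  `(2,1)` at `ι₁` and positive definiteness off `ι₁` are transported through `B^τ` (`HermSpace3.map_formCongr`; Sylvester frames
  compose, `formCongr_mul`), so every `HermSpace3` / `Level` / `HComp` declaration applies to the diagonal form by name, and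
  `V.diag.adelicFin = UnitaryGroup.finAdelic L⁺ L c 3 (diagonal V.diagEntries)` definitionally;
* **`V.adelicFinDiag : V.adelicFin ≃ₜ* UnitaryGroup.finAdelic L⁺ L c 3 (diagonal V.diagEntries)`**, `g ↦ B_f⁻¹ g B_f`
  (topological groups; tree `UnitaryGroup.finAdelicCongr`, [PlatonovRapinchuk1994, §2.3]); its underlying homomorphism
  `ι := V.adelicFinDiag.toMulEquiv.toMonoidHom` (continuous, `continuous_adelicFinDiag_toMonoidHom`) is the
  `ι : G →* U(J_V)(𝔸_{F,f})` of the ω file at `G := V.adelicFin` (= `(Model.honestP5Of h F ι₁ V Φ).G`, `HComp/HonestP5Of.lean`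
  `honestP5Of_G`, `rfl`), `J_V := diagonal V.diagEntries`;
* levels of `V` and of `V.diag` correspond BY NAME under the tree's `Level.transport` (`CorCM/HermSpaceTransport.lean`) at
  `formCongr_diagFrame_one_smul` / `formCongr_diagFrame_inv_one_smul` (arithmetic level `B⁻¹ Γ B` exactly, compact open
  `B_f⁻¹ K B_f`, torsion-free; `mem_transport_diagFrame_K_iff`, `nonempty_level_diag_iff`).

Everything is proved; two choices (`diagFrame`, `diagEntries`) and two bundlings (`diag`, `adelicFinDiag`) are the only
definitions.  T5: n/a (no hypothesis binder).  References: W. Landherr, Abh. Math. Sem.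
Hamburg 11 (1936) [Landherr1936HermitianForms]; Platonov–Rapinchuk 1994 §2.3 [PlatonovRapinchuk1994]; [Liu2021] §4.2 l. 2053,
App. C l. 4624 (`𝔾(𝔸_F^∞) ≃ G(τ)(𝔸^∞)`), Def. 4.11.
-/

noncomputable section

open scoped Matrix ComplexOrder
open NumberField
open Literature.NumberTheory.Automorphic
open Literature.NumberTheory.QuadraticForms
open Literature.AlgebraicGeometry.ShimuraVarieties

namespace Summit.HodgeConjecture.CorCM

/-! ## §0  Two generic identities for `formCongr` -/

section Generic

variable {R : Type*} [CommRing R] {n : Type*} [Fintype n] [DecidableEq n] (σ : R →+* R)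

/-- **Changes of basis compose**: `formCongr σ (S·T) H = formCongr σ T (formCongr σ S H)`, i.e.
`ᵗσ(ST) H (ST) = ᵗσT (ᵗσS H S) T`. [folklore] -/
theorem formCongr_mul (S T : GL n R) (H : Matrix n n R) :
    formCongr σ (S * T) H = formCongr σ T (formCongr σ S H) := by
  simp only [formCongr, Units.val_mul, Matrix.map_mul, Matrix.transpose_mul, Matrix.mul_assoc]

end Generic

/-- Coercion bookkeeping for continuous group isomorphisms: the monoid homomorphism underlying `f : M ≃ₜ* N` is `f` as a
function (generic, so that the kernel never unfolds a concrete `f`). [folklore] -/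
theorem coe_toMulEquiv_toMonoidHom {M N : Type*} [TopologicalSpace M] [TopologicalSpace N] [Group M] [Group N]
    (f : M ≃ₜ* N) : ⇑f.toMulEquiv.toMonoidHom = ⇑f := rfl

/-- A continuous group isomorphism pulls back exactly the open sets to open sets (generic `Homeomorph.isOpen_preimage`).
[folklore] -/
theorem isOpen_preimage_continuousMulEquiv_iff {M N : Type*} [TopologicalSpace M] [TopologicalSpace N] [Mul M] [Mul N]
    (f : M ≃ₜ* N) (s : Set N) : IsOpen (f ⁻¹' s) ↔ IsOpen s :=
  f.toHomeomorph.isOpen_preimage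

namespace HermSpace3

variable {L : CMField} {ι₁ : L →+* ℂ} (V : HermSpace3 L ι₁)

/-! ## §1  A complex embedding carries an `L`-rational change of basis to a complex one -/

/-- **`τ(ᵗ(c̄B) · H · B) = (B^τ)ᴴ · τ(H) · B^τ`**: a complex embedding `τ` intertwines complex conjugation of the CM field with
complex conjugation of `ℂ` (Mathlib `IsCMField.complexEmbedding_complexConj`), so it carries an `L`-rational change of basis of a
sesquilinear form to the conjugate-transpose change of basis by `B^τ = τ(B) ∈ GL₃(ℂ)` (tree `formCongr_map`, `formCongr_star`).
[cite: PlatonovRapinchuk1994, §2.3] -/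
theorem map_formCongr (B : GL (Fin 3) L) (H : Matrix (Fin 3) (Fin 3) L) (τ : L →+* ℂ) :
    (formCongr (cmConjRingHom L) B H).map τ =
      formCongr (starRingEnd ℂ) (Matrix.GeneralLinearGroup.map τ B) (H.map τ) :=
  formCongr_map (cmConjRingHom L) τ (embedding_cmConjRingHom L τ) B H

/-- The same with the right-hand side spelled `(B^τ)ᴴ · τ(H) · B^τ`. [cite: PlatonovRapinchuk1994, §2.3] -/
theorem map_formCongr_eq_conjTranspose_mul_mul (B : GL (Fin 3) L) (H : Matrix (Fin 3) (Fin 3) L) (τ : L →+* ℂ) :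
    (formCongr (cmConjRingHom L) B H).map τ =
      ((Matrix.GeneralLinearGroup.map τ B : GL (Fin 3) ℂ) : Matrix (Fin 3) (Fin 3) ℂ)ᴴ * H.map τ *
        ((Matrix.GeneralLinearGroup.map τ B : GL (Fin 3) ℂ) : Matrix (Fin 3) (Fin 3) ℂ) := by
  rw [map_formCongr, formCongr_star]

/-! ## §2  Existence of an `L`-rational diagonal frame -/

/-- **Every hermitian 3-space admits an `L`-rational diagonal frame**: there are `B ∈ GL₃(L)` and `d : Fin 3 → L` with every
`dᵢ` fixed by complex conjugation and non-zero such that `ᵗ(c̄B) · V.Hm · B = diag(d₁, d₂, d₃)` — symmetric Gauss elimination of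
the non-degenerate hermitian matrix `V.Hm` over the CM field (tree `Landherr.exists_congr_diagonal`; `V.Hm` is hermitian in
Landherr's currency and `det V.Hm ≠ 0`, `CorCM/HermSpaceTransport.lean`).  In particular `diag(d)` lies in the image of
`M₃(L⁺)`, the Gram-matrix shape `J_V = T_V ⊗_{L⁺} L` of the unitary dual-pair files. [cite: Landherr1936HermitianForms] -/
theorem exists_diagonalFrame :
    ∃ (B : GL (Fin 3) L) (d : Fin 3 → L), (∀ i, IsCMField.complexConj L (d i) = d i) ∧ (∀ i, d i ≠ 0) ∧
      formCongr (cmConjRingHom L) B V.Hm = Matrix.diagonal d := by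
  obtain ⟨G, hG, d, hd, hd0, hG'⟩ :=
    Landherr.exists_congr_diagonal L V.Hm V.transpose_map_complexConj V.det_ne_zero
  have hu : IsUnit G := (Matrix.isUnit_iff_isUnit_det G).2 hG
  refine ⟨hu.unit, d, hd, hd0, ?_⟩
  rw [← hG', formCongr, IsUnit.unit_spec, ← Matrix.transpose_map]
  rfl

/-! ## §3  A chosen diagonal frame (named terms) -/

/-- **The chosen diagonal frame** `B = V.diagFrame ∈ GL₃(L)` of the hermitian 3-space (`Exists.choose` on
`exists_diagonalFrame`; any two choices give congruent diagonal forms and conjugate transports). [cite: Landherr1936HermitianForms] -/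
def diagFrame : GL (Fin 3) L := V.exists_diagonalFrame.choose

/-- **The chosen diagonal entries** `d = V.diagEntries : Fin 3 → L` (`Exists.choose`), so that
`ᵗ(c̄ V.diagFrame) · V.Hm · V.diagFrame = diag(V.diagEntries)`. [cite: Landherr1936HermitianForms] -/
def diagEntries : Fin 3 → L := V.exists_diagonalFrame.choose_spec.choose

/-- The chosen diagonal entries are fixed by complex conjugation (they lie in `L⁺`) — the argument `hdV` of
`GelbartRogawski1991.UnitaryDualPair.realDiagonal` / `cmSplittingDatum`. [cite: Landherr1936HermitianForms] -/
theorem complexConj_diagEntries (i : Fin 3) : IsCMField.complexConj L (V.diagEntries i) = V.diagEntries i :=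
  V.exists_diagonalFrame.choose_spec.choose_spec.1 i

/-- The same in the `cmConjRingHom` spelling. [cite: Landherr1936HermitianForms] -/
theorem cmConjRingHom_diagEntries (i : Fin 3) : cmConjRingHom L (V.diagEntries i) = V.diagEntries i :=
  V.complexConj_diagEntries i

/-- The chosen diagonal entries lie in the maximal real subfield `L⁺`. [cite: Landherr1936HermitianForms] -/
theorem diagEntries_mem_maximalRealSubfield (i : Fin 3) : V.diagEntries i ∈ maximalRealSubfield L :=
  (IsCMField.complexConj_eq_self_iff (K := L) (V.diagEntries i)).1 (V.complexConj_diagEntries i)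

/-- The chosen diagonal entries are non-zero — the argument `hdV0` of `cmSplittingDatum` (`isUnit_det_realDiagonal`).
[cite: Landherr1936HermitianForms] -/
theorem diagEntries_ne_zero (i : Fin 3) : V.diagEntries i ≠ 0 :=
  V.exists_diagonalFrame.choose_spec.choose_spec.2.1 i

/-- **The frame equation** `ᵗ(c̄ V.diagFrame) · V.Hm · V.diagFrame = diag(V.diagEntries)`. [cite: Landherr1936HermitianForms] -/
theorem formCongr_diagFrame : formCongr (cmConjRingHom L) V.diagFrame V.Hm = Matrix.diagonal V.diagEntries :=
  V.exists_diagonalFrame.choose_spec.choose_spec.2.2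

/-- The diagonal Gram matrix at a complex embedding: `τ(diag d) = (B^τ)ᴴ · τ(V.Hm) · B^τ`. [cite: PlatonovRapinchuk1994, §2.3] -/
theorem map_diagonal_diagEntries (τ : L →+* ℂ) :
    (Matrix.diagonal V.diagEntries).map τ =
      ((Matrix.GeneralLinearGroup.map τ V.diagFrame : GL (Fin 3) ℂ) : Matrix (Fin 3) (Fin 3) ℂ)ᴴ * V.Hm.map τ *
        ((Matrix.GeneralLinearGroup.map τ V.diagFrame : GL (Fin 3) ℂ) : Matrix (Fin 3) (Fin 3) ℂ) := by
  rw [← V.formCongr_diagFrame, map_formCongr_eq_conjTranspose_mul_mul]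

/-! ## §4  The diagonal form is a hermitian 3-space with the same `ι₁` («keeping the signatures») -/

/-- A diagonal matrix with conjugation-fixed entries is hermitian in the tree's `HermSpace3` currency. [folklore] -/
theorem isHermitian_diagonal {d : Fin 3 → L} (hd : ∀ i, IsCMField.complexConj L (d i) = d i) (i j : Fin 3) :
    cmConjRingHom L (Matrix.diagonal d i j) = Matrix.diagonal d j i := by
  by_cases h : i = j
  · subst h
    rw [Matrix.diagonal_apply_eq, cmConjRingHom_apply]
    exact hd i
  · rw [Matrix.diagonal_apply_ne _ h, Matrix.diagonal_apply_ne _ (Ne.symm h), map_zero]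

/-- **Signature `(2,1)` at `ι₁` survives diagonalisation**: a Sylvester frame `T` of `ι₁(V.Hm)` gives the Sylvester frame
`(B^{ι₁})⁻¹ T` of `ι₁(diag d)` (changes of basis compose). [cite: Landherr1936HermitianForms] -/
theorem signature_diagonal_diagEntries :
    ∃ T : GL (Fin 3) ℂ, (T : Matrix (Fin 3) (Fin 3) ℂ)ᴴ * (Matrix.diagonal V.diagEntries).map ι₁ * (T : Matrix _ _ ℂ) =
      signatureMatrix 2 := by
  obtain ⟨T, hT⟩ := V.signature_ι₁
  refine ⟨(Matrix.GeneralLinearGroup.map ι₁ V.diagFrame)⁻¹ * T, ?_⟩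
  rw [← formCongr_star] at hT ⊢
  rw [← V.formCongr_diagFrame, map_formCongr, ← formCongr_mul, ← mul_assoc, mul_inv_cancel, one_mul]
  exact hT

/-- **Positive definiteness off `ι₁` survives diagonalisation**: `τ(diag d) = (B^τ)ᴴ τ(V.Hm) B^τ` with `B^τ` invertible
(Mathlib `Matrix.PosDef.conjTranspose_mul_mul_same`). [cite: Landherr1936HermitianForms] -/
theorem posDef_diagonal_diagEntries (τ : L →+* ℂ) (hτ : InfinitePlace.mk τ ≠ InfinitePlace.mk ι₁) :
    ((Matrix.diagonal V.diagEntries).map τ).PosDef := by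
  rw [V.map_diagonal_diagEntries τ]
  exact (V.posDef_of_ne τ hτ).conjTranspose_mul_mul_same
    (Matrix.mulVec_injective_iff_isUnit.2 (Matrix.GeneralLinearGroup.map τ V.diagFrame).isUnit)

/-- **The diagonal form as a hermitian 3-space** `V.diag : HermSpace3 L ι₁` — Gram matrix `diag(V.diagEntries)`, the SAME
distinguished embedding `ι₁`, signature `(2,1)` there and `(3,0)` elsewhere; congruent to `V` over `L` by `V.diagFrame`.
[cite: Landherr1936HermitianForms] -/
def diag : HermSpace3 L ι₁ where
  Hm := Matrix.diagonal V.diagEntries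
  isHermitian := isHermitian_diagonal V.complexConj_diagEntries
  signature_ι₁ := V.signature_diagonal_diagEntries
  posDef_of_ne := V.posDef_diagonal_diagEntries

/-- The Gram matrix of `V.diag` is `diag(V.diagEntries)` (definitional). [folklore] -/
theorem diag_Hm : V.diag.Hm = Matrix.diagonal V.diagEntries := rfl

/-- The finite-adelic unitary group of `V.diag` IS the dual-pair files' `UnitaryGroup.finAdelic L⁺ L c 3 (diag d)` (definitional).
[cite: PlatonovRapinchuk1994, §5.1] -/
theorem diag_adelicFin :
    V.diag.adelicFin =
      UnitaryGroup.finAdelic (↥(maximalRealSubfield L)) L (IsCMField.complexConj L) 3 (Matrix.diagonal V.diagEntries) := rfl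

/-- The frame equation in the shape consumed by `UnitaryGroup.finAdelicCongr` / `Level.transport` (scalar `a = 1`):
`ᵗ(c̄B) · (1 • V.Hm) · B = V.diag.Hm`. [cite: Landherr1936HermitianForms] -/
theorem formCongr_diagFrame_one_smul : formCongr (cmConjRingHom L) V.diagFrame ((1 : L) • V.Hm) = V.diag.Hm := by
  rw [one_smul]
  exact V.formCongr_diagFrame

/-- The inverse frame equation: `ᵗ(c̄B⁻¹) · (1 • V.diag.Hm) · B⁻¹ = V.Hm` (changing basis back). [cite: Landherr1936HermitianForms] -/
theorem formCongr_diagFrame_inv_one_smul : formCongr (cmConjRingHom L) V.diagFrame⁻¹ ((1 : L) • V.diag.Hm) = V.Hm := by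
  rw [one_smul, diag_Hm, ← V.formCongr_diagFrame, formCongr_inv_formCongr]

/-! ## §5  The finite-adelic transport `U(V.Hm)(𝔸_{L⁺,f}) ≃ₜ* U(diag d)(𝔸_{L⁺,f})` -/

/-- **The finite-adelic transport along the diagonal frame**: `V.adelicFin ≃ₜ* V.diag.adelicFin = U(diag d)(𝔸_{L⁺,f})`,
`g ↦ B_f⁻¹ g B_f` (`B_f` = the diagonal image of `B = V.diagFrame` in `GL₃(𝔸_L^∞)`), an isomorphism of topological groups inside
`GL₃(𝔸_L^∞)` (tree `UnitaryGroup.finAdelicCongr` at the similitude `ᵗ(c̄B) · (1 • V.Hm) · B = diag d`, inverted).  The target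
`V.diag.adelicFin` IS (`diag_adelicFin`, `rfl`) the group `UnitaryGroup.finAdelic L⁺ L c 3 (diagonal V.diagEntries) = U(J_V)(𝔸_{F,f})`
of the unitary dual-pair files at `J_V := V.diag.Hm = diagonal V.diagEntries`.  This is the pull-back `ι : 𝔾(𝔸_F^∞) → U(J_V)(𝔸_{F,f})`
along which the ω-side carrier `ω(μ, ε, χ)` of [Liu2021] Def. 4.11 (the Weil χ-coinvariants of the dual pair,
`GelbartRogawski1991.UnitaryDualPair.WeilCoinv.weilCoinv`) is restricted to the group `G := V.adelicFin` of the Appendix-C datum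
(`ι := V.adelicFinDiag.toMulEquiv.toMonoidHom`, continuous by `continuous_adelicFinDiag_toMonoidHom`). [cite: PlatonovRapinchuk1994, §2.3] -/
def adelicFinDiag : V.adelicFin ≃ₜ* V.diag.adelicFin :=
  (UnitaryGroup.finAdelicCongr (↥(maximalRealSubfield L)) L (IsCMField.complexConj L) V.diagFrame
    (one_ne_zero (α := L)) (Level.formCongr_complexConj_eq V.formCongr_diagFrame_one_smul)).symm

/-- `adelicFinDiag` on underlying matrices: `g ↦ B_f⁻¹ g B_f`. [cite: PlatonovRapinchuk1994, §2.3] -/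
@[simp] theorem coe_adelicFinDiag_apply (g : V.adelicFin) :
    ((V.adelicFinDiag g : V.diag.adelicFin) : GL (Fin 3) (IsDedekindDomain.FiniteAdeleRing (𝓞 L) L)) =
      (UnitaryGroup.toFinAdeleGL L 3 V.diagFrame)⁻¹ * (g : GL (Fin 3) (IsDedekindDomain.FiniteAdeleRing (𝓞 L) L)) *
        UnitaryGroup.toFinAdeleGL L 3 V.diagFrame :=
  rfl

/-- `adelicFinDiag.symm` on underlying matrices: `g ↦ B_f g B_f⁻¹`. [cite: PlatonovRapinchuk1994, §2.3] -/
@[simp] theorem coe_adelicFinDiag_symm_apply (g : V.diag.adelicFin) :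
    ((V.adelicFinDiag.symm g : V.adelicFin) : GL (Fin 3) (IsDedekindDomain.FiniteAdeleRing (𝓞 L) L)) =
      UnitaryGroup.toFinAdeleGL L 3 V.diagFrame * (g : GL (Fin 3) (IsDedekindDomain.FiniteAdeleRing (𝓞 L) L)) *
        (UnitaryGroup.toFinAdeleGL L 3 V.diagFrame)⁻¹ :=
  rfl

/-- `adelicFinDiag` is continuous (as a bare function; for `Continuous`-hypothesis consumers). [folklore] -/
theorem continuous_adelicFinDiag : Continuous V.adelicFinDiag := V.adelicFinDiag.continuous

/-- `adelicFinDiag.symm` is continuous. [folklore] -/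
theorem continuous_adelicFinDiag_symm : Continuous V.adelicFinDiag.symm := V.adelicFinDiag.symm.continuous

/-- **The transport as a group homomorphism is continuous**: `ι := V.adelicFinDiag.toMulEquiv.toMonoidHom :
V.adelicFin →* U(diag d)(𝔸_{L⁺,f})` has the shape `(ι : G →* UnitaryGroup.finAdelic F E c N J_V)` of the ω file's pull-back, and
this is its continuity hypothesis `hι` (under which `WeilCoinv.weilCoinv_comp_smooth` makes the restricted Weil coinvariants a
smooth `G`-module, [Liu2021] Def. 4.11 «smooth»). [folklore] -/
theorem continuous_adelicFinDiag_toMonoidHom : Continuous V.adelicFinDiag.toMulEquiv.toMonoidHom := by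
  rw [coe_toMulEquiv_toMonoidHom]
  exact V.adelicFinDiag.continuous

/-- `ι` is injective (indeed bijective). [folklore] -/
theorem adelicFinDiag_toMonoidHom_injective : Function.Injective V.adelicFinDiag.toMulEquiv.toMonoidHom := by
  rw [coe_toMulEquiv_toMonoidHom]
  exact EquivLike.injective V.adelicFinDiag

/-- A subgroup `S` of `U(diag d)(𝔸_{L⁺,f})` is open iff its preimage under `ι` is open in `V.adelicFin` (`ι` is a homeomorphism) —
open stabilisers pull back to open stabilisers and conversely. [folklore] -/
theorem isOpen_comap_adelicFinDiag_iff (S : Subgroup V.diag.adelicFin) :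
    IsOpen (S.comap V.adelicFinDiag.toMulEquiv.toMonoidHom : Set V.adelicFin) ↔ IsOpen (S : Set V.diag.adelicFin) := by
  rw [Subgroup.coe_comap, coe_toMulEquiv_toMonoidHom]
  exact isOpen_preimage_continuousMulEquiv_iff V.adelicFinDiag _

/-! ## §6  Levels of `V` and of `V.diag` correspond (tree `Level.transport`, by name) -/

/-- **Levels transport to the diagonal form BY NAME**: for a level `Γ` of `V`, the tree's
`Γ.transport V.diagFrame one_ne_zero V.formCongr_diagFrame_one_smul : Level V.diag` (`CorCM/HermSpaceTransport.lean`) is the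
level `(B⁻¹ Γ B, B_f⁻¹ K B_f)`; its compact open is the image of `K` under `adelicFinDiag`: `g ∈ K' ↔ B_f g B_f⁻¹ ∈ K`.
[cite: PlatonovRapinchuk1994, §4.1] -/
theorem mem_transport_diagFrame_K_iff (Γ : Level V) (g : V.diag.adelicFin) :
    g ∈ (Γ.transport V.diagFrame (one_ne_zero (α := L)) V.formCongr_diagFrame_one_smul).K ↔ V.adelicFinDiag.symm g ∈ Γ.K := by
  rw [Level.transport_K, Subgroup.mem_comap, coe_toMulEquiv_toMonoidHom, adelicFinDiag, ContinuousMulEquiv.symm_symm]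

/-- The arithmetic group of the transported level is `B⁻¹ Γ B`: `γ ∈ Γ' ↔ B γ B⁻¹ ∈ Γ`. [cite: PlatonovRapinchuk1994, §4.1] -/
theorem mem_transport_diagFrame_Γ_iff (Γ : Level V) {γ : GL (Fin 3) L} :
    γ ∈ (Γ.transport V.diagFrame (one_ne_zero (α := L)) V.formCongr_diagFrame_one_smul).Γ ↔
      V.diagFrame * γ * V.diagFrame⁻¹ ∈ Γ.Γ :=
  Iff.rfl

/-- **Levels of the diagonal form exist as soon as levels of `V` do, and conversely** (transport along `B`, resp. `B⁻¹`,
`formCongr_diagFrame_one_smul` / `formCongr_diagFrame_inv_one_smul`). [folklore] -/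
theorem nonempty_level_diag_iff : Nonempty (Level V.diag) ↔ Nonempty (Level V) :=
  ⟨fun ⟨Γ'⟩ ↦ ⟨Γ'.transport V.diagFrame⁻¹ (one_ne_zero (α := L)) V.formCongr_diagFrame_inv_one_smul⟩,
    fun ⟨Γ⟩ ↦ ⟨Γ.transport V.diagFrame (one_ne_zero (α := L)) V.formCongr_diagFrame_one_smul⟩⟩

end HermSpace3

end Summit.HodgeConjecture.CorCM

end
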